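import Literature.InformationTheory.QuantumCodes.QuantumDistanceCriterion
import HarnessLib

/-!
# The purity clauses of Rains's quantum Singleton bound — proofs

Topic `Literature/InformationTheory/QuantumCodes` (venture QEC, cell `qec`, PARTITION v2 row 06 / D2.6, rung X1).
E. M. Rains, *Nonbinary quantum codes*, IEEE Trans. Inform. Theory 45 (1999) 1827–1832 = arXiv:quant-ph/9703048
[Rains1999Nonbinary], Thm. 2: «Let `𝒞` be a `((n,K,d))_α` with `K > 1`. Then `K ≤ α^{n−2d+2}`. If equality holds,
then `𝒞` is pure to weight `n−d+2`. Similarly, a pure `((n,1,d))_α` satisfies `2d ≤ n+2`.» («the purity result is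
apparently new»). The bound itself (`α = 2`) is `Rains1999_quantumSingleton_holds` (QuantumSingletonBoundGeneral.lean,
this seat); `WeightEnumeratorBounds.lean` notes «the purity and `K = 1` clauses are not restated» — this file PROVES
both remaining clauses for qubit codes carried by their projection:

* §1 the **two-block chain inequality** behind Thm. 2: for disjoint qubit sets `S`, `S'` of size `≤ d − 1`,
  `K²·4^{|S|+|S'|}·pauliWeight P S'ᶜ ≤ 4ⁿ·pauliWeight P S` (cleaning identity on `S` and on `S'` + monotonicity);
* §2 **purity at equality** (quantum MDS codes): if `K > 1` and `K·2^{2(d−1)} = 2ⁿ` then `Tr(EP) = 0` for every Pauli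
  word with `0 < wt(E) < n − d + 2` (`isPureToWeight_of_quantumMDS`) — at equality the chain is tight, so the Fourier
  weight of `P` on `S'ᶜ` equals that on `S ⊆ S'ᶜ`, killing every coefficient supported in `S'ᶜ` but not in `S`;
* §3 the **`K = 1` clause**: a pure `((n,1,d))` on `n ≥ 1` qubits has `2(d−1) ≤ n` (`two_mul_le_of_pure_rank_one`;
  for `n = 0` the purity hypothesis is vacuous, so `n ≥ 1` — implicit in print — is explicit here).

All theorems: column proved; no named facts, no new definitions.

## Mathlib / tree search

Tree: `pauliWeight_eq_mul_pauliWeight_compl` (cleaning identity), `pauliWt_le_card_of_mem_stringsOn`,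
`slBOn_eq_slAOn_compl`, `slAOn_self_of_isHermitian` (QuantumSingletonBoundGeneral); `detectsWeightLE_iff_forall_pauliWeight`
(QuantumDistanceCriterion, for the `K = 1` detection); `norm_pauliCoeff_sq_le` (QuantumMacWilliams); `pauliWeight`, `pauliWeight_mono`,
`pauliWeight_empty`, `stringsOn`, `mem_stringsOn`, `stringsOn_mono`, `pauliCoeff` (QuantumComplexity);
`IsCodeProjection`, `IsPureToWeight`, `pauliWt` (WeightEnumeratorBounds). Mathlib: `Finset.exists_subset_card_eq`,
`Finset.sum_sdiff`, `Finset.sum_eq_zero_iff_of_nonneg`.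
-/

noncomputable section

open Finset Matrix
open Literature.Computability.QuantumComplexity

namespace Literature.InformationTheory.QuantumCodes

variable {ι : Type*} [Fintype ι] [DecidableEq ι]

/-! ### §1. The two-block chain inequality -/

/-- **The chain inequality of Rains's Singleton proof.** For a Hermitian idempotent `P` of trace `K` detecting every
error of weight `≤ t`, and qubit sets `S' ⊆ Sᶜ` with `|S|, |S'| ≤ t`:
`K²·4^{|S|+|S'|}·pauliWeight P S'ᶜ ≤ 4ⁿ·pauliWeight P S` — from `2ⁿ a_{S'} = K 4^{|S'|} a_{S'ᶜ}`,
`a_{S'} ≤ a_{Sᶜ}` and `2ⁿ a_S = K 4^{|S|} a_{Sᶜ}` («`A'_{n−d+1} = B'_{d−1}` … `B_i = K^{−1}A_i` for `0 ≤ i ≤ d−1`»).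
[cite: Rains1999Nonbinary, Thm. 2 p. 1828 (proof)] -/
theorem chain_le {P : Matrix (ι → Bool) (ι → Bool) ℂ} (hH : P.IsHermitian) (hPP : P * P = P) {K : ℕ}
    (htr : P.trace = (K : ℂ)) {t : ℕ} (hdet : DetectsWeightLE P t) {S S' : Finset ι} (hdisj : S' ⊆ Sᶜ)
    (hS : #S ≤ t) (hS' : #S' ≤ t) :
    (K : ℝ) ^ 2 * 4 ^ (#S + #S') * pauliWeight P S'ᶜ ≤ 4 ^ Fintype.card ι * pauliWeight P S := by
  have e1 := pauliWeight_eq_mul_pauliWeight_compl hH hPP htr hdet hS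
  have e2 := pauliWeight_eq_mul_pauliWeight_compl hH hPP htr hdet hS'
  have m1 : pauliWeight P S' ≤ pauliWeight P Sᶜ := pauliWeight_mono P hdisj
  have h2n : (2 : ℝ) ^ Fintype.card ι ≠ 0 := by positivity
  have h4n : (4 : ℝ) ^ Fintype.card ι = 2 ^ Fintype.card ι * 2 ^ Fintype.card ι := by rw [← mul_pow]; norm_num
  -- clear the denominators: `2ⁿ a_S = K 4^{|S|} a_{Sᶜ}`, `2ⁿ a_{S'} = K 4^{|S'|} a_{S'ᶜ}`
  have f1 : (2 : ℝ) ^ Fintype.card ι * pauliWeight P S = K * 4 ^ #S * pauliWeight P Sᶜ := by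
    rw [e1]; field_simp
  have f2 : (2 : ℝ) ^ Fintype.card ι * pauliWeight P S' = K * 4 ^ #S' * pauliWeight P S'ᶜ := by
    rw [e2]; field_simp
  have hK4 : (0 : ℝ) ≤ K * 4 ^ #S := by positivity
  calc (K : ℝ) ^ 2 * 4 ^ (#S + #S') * pauliWeight P S'ᶜ
      = K * 4 ^ #S * (K * 4 ^ #S' * pauliWeight P S'ᶜ) := by rw [pow_add]; ring
    _ = K * 4 ^ #S * (2 ^ Fintype.card ι * pauliWeight P S') := by rw [f2]
    _ ≤ K * 4 ^ #S * (2 ^ Fintype.card ι * pauliWeight P Sᶜ) := by gcongr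
    _ = 2 ^ Fintype.card ι * (K * 4 ^ #S * pauliWeight P Sᶜ) := by ring
    _ = 2 ^ Fintype.card ι * (2 ^ Fintype.card ι * pauliWeight P S) := by rw [f1]
    _ = 4 ^ Fintype.card ι * pauliWeight P S := by rw [h4n]; ring

/-! ### §2. Purity at equality (quantum MDS codes) -/

/-- A coefficient supported in `W'` but not in `W ⊆ W'` vanishes when the Fourier weights on `W` and `W'` agree.
[cite: Rains1999Nonbinary, Thm. 2 p. 1828 («If equality holds, then `𝒞` is pure to weight `n−d+2`»)] -/
theorem pauliCoeff_eq_zero_of_pauliWeight_eq {P : Matrix (ι → Bool) (ι → Bool) ℂ} {W W' : Finset ι} (hWW' : W ⊆ W')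
    (heq : pauliWeight P W' = pauliWeight P W) {E : ι → Pauli} (hE : E ∈ stringsOn W') (hEW : E ∉ stringsOn W) :
    pauliCoeff P E = 0 := by
  have hsub : stringsOn W ⊆ stringsOn W' := stringsOn_mono hWW'
  have hsplit := Finset.sum_sdiff hsub (f := fun S => ‖pauliCoeff P S‖ ^ 2)
  rw [← pauliWeight_eq, ← pauliWeight_eq, heq] at hsplit
  have hzero : ∑ S ∈ stringsOn W' \ stringsOn W, ‖pauliCoeff P S‖ ^ 2 = 0 := by linarith
  have h := (Finset.sum_eq_zero_iff_of_nonneg (fun S _ => by positivity)).1 hzero E (Finset.mem_sdiff.2 ⟨hE, hEW⟩)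
  simpa using h

/-- **Purity at Singleton equality (quantum MDS codes are pure to weight `n − d + 2`).** If `P` is the projection
onto an `((n,K,d))` with `K > 1` and `K·2^{2(d−1)} = 2ⁿ` (equality in `K ≤ 2^{n−2d+2}`), then `Tr(EP) = 0` for every
Pauli word `E` with `0 < wt(E) < n − d + 2`. (Blocks: `S'` of size `d−1` avoiding `supp E`, `S` of size `d−1`
avoiding `S'` and one qubit of `supp E`; at equality `chain_le` and monotonicity give
`pauliWeight P S'ᶜ = pauliWeight P S`.) [cite: Rains1999Nonbinary, Thm. 2 p. 1828 («If equality holds, then `𝒞` is pure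
to weight `n−d+2`»; «the purity result is apparently new»)] -/
theorem isPureToWeight_of_quantumMDS {K d : ℕ} {P : Matrix (ι → Bool) (ι → Bool) ℂ} (hK : 1 < K)
    (hP : IsCodeProjection P K d) (hMDS : K * 2 ^ (2 * (d - 1)) = 2 ^ Fintype.card ι) :
    IsPureToWeight P (Fintype.card ι - d + 2) := by
  classical
  obtain ⟨hH, hPP, htr, hdet⟩ := hP
  intro E hpos hlt
  -- numerics from equality: `2(d−1) + 1 ≤ n`
  have hnd : 2 * (d - 1) + 1 ≤ Fintype.card ι := by
    have h1 : 2 ^ (2 * (d - 1) + 1) ≤ 2 ^ Fintype.card ι := by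
      rw [pow_succ, ← hMDS, mul_comm]
      exact Nat.mul_le_mul_right _ hK
    exact (Nat.pow_le_pow_iff_right (by norm_num)).1 h1
  -- the support `T` of `E`
  set T : Finset ι := univ.filter fun i => E i ≠ Pauli.I with hT
  have hTcard : #T = pauliWt E := rfl
  have hET : E ∈ stringsOn T := mem_stringsOn.2 fun i hi => by simpa [hT] using hi
  -- block `S'` of size `d − 1` inside `Tᶜ`
  obtain ⟨S', hS'T, hS'⟩ := Finset.exists_subset_card_eq (s := Tᶜ) (n := d - 1)
    (by rw [Finset.card_compl, hTcard]; omega)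
  -- a qubit `e` of the support, and a block `S` of size `d − 1` avoiding `S' ∪ {e}`
  obtain ⟨e, he⟩ : T.Nonempty := by rw [← Finset.card_pos, hTcard]; exact hpos
  have heS' : e ∉ S' := fun h => Finset.mem_compl.1 (hS'T h) he
  obtain ⟨S, hSsub, hS⟩ := Finset.exists_subset_card_eq (s := (insert e S')ᶜ) (n := d - 1)
    (by rw [Finset.card_compl, Finset.card_insert_of_notMem heS', hS']; omega)
  have hdisj : S' ⊆ Sᶜ := fun i hi => Finset.mem_compl.2 fun hiS =>
    Finset.mem_compl.1 (hSsub hiS) (Finset.mem_insert_of_mem hi)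
  have heS : e ∉ S := fun h => Finset.mem_compl.1 (hSsub h) (Finset.mem_insert_self _ _)
  have hSS'c : S ⊆ S'ᶜ := fun i hi => Finset.mem_compl.2 fun hi' => Finset.mem_compl.1 (hdisj hi') hi
  -- the chain at equality
  have hchain := chain_le hH hPP htr hdet hdisj (by rw [hS]) (by rw [hS'])
  rw [hS, hS', ← two_mul] at hchain
  have hKsq : (K : ℝ) ^ 2 * 4 ^ (2 * (d - 1)) = 4 ^ Fintype.card ι := by
    have h : ((K * 2 ^ (2 * (d - 1)) : ℕ) : ℝ) = ((2 ^ Fintype.card ι : ℕ) : ℝ) := by rw [hMDS]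
    push_cast at h
    have e4 : ∀ m : ℕ, (4 : ℝ) ^ m = (2 ^ m) ^ 2 := fun m => by
      rw [← pow_mul, mul_comm, pow_mul]; norm_num
    rw [e4, e4, ← h]; ring
  rw [hKsq] at hchain
  have h4n : (0 : ℝ) < 4 ^ Fintype.card ι := by positivity
  have hle : pauliWeight P S'ᶜ ≤ pauliWeight P S := le_of_mul_le_mul_left hchain h4n
  have heq : pauliWeight P S'ᶜ = pauliWeight P S := le_antisymm hle (pauliWeight_mono P hSS'c)
  -- `E` is supported in `S'ᶜ` but not in `S`
  have hES'c : E ∈ stringsOn S'ᶜ :=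
    stringsOn_mono (fun i hi => Finset.mem_compl.2 fun hi' => Finset.mem_compl.1 (hS'T hi') hi) hET
  have hES : E ∉ stringsOn S := fun h => by
    have := mem_stringsOn.1 h e heS
    exact (Finset.mem_filter.1 he).2 this
  rw [← pauliCoeff_eq]
  exact pauliCoeff_eq_zero_of_pauliWeight_eq hSS'c heq hES'c hES

/-! ### §3. The `K = 1` clause -/

/-- For a PURE code the Fourier weight on a small set sees only the identity: if `Tr(EP) = 0` for `0 < wt E < d` and
`|W| ≤ d − 1` then `pauliWeight P W = |Tr P|²`. [cite: Rains1999Nonbinary, Thm. 2 p. 1828 (proof, K = 1: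
«`A'_i = …` for `0 ≤ i ≤ d−1`»)] -/
theorem pauliWeight_eq_of_pure {P : Matrix (ι → Bool) (ι → Bool) ℂ} {d : ℕ} (hpure : IsPureToWeight P d)
    {W : Finset ι} (hW : #W ≤ d - 1) : pauliWeight P W = ‖P.trace‖ ^ 2 := by
  rw [← pauliWeight_empty, pauliWeight_eq, pauliWeight_eq, stringsOn_empty, Finset.sum_singleton]
  rw [← Finset.sum_erase_add _ _ (show (fun _ : ι => Pauli.I) ∈ stringsOn W from
    mem_stringsOn.2 fun _ _ => rfl)]
  rw [Finset.sum_eq_zero, zero_add]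
  intro E hE
  obtain ⟨hne, hEW⟩ := Finset.mem_erase.1 hE
  have hpos : 0 < pauliWt E := by
    rw [pauliWt, Finset.card_pos]
    by_contra hc
    rw [Finset.not_nonempty_iff_eq_empty, Finset.filter_eq_empty_iff] at hc
    exact hne (funext fun i => not_not.1 (hc (Finset.mem_univ i)))
  have hle : pauliWt E ≤ d - 1 := (pauliWt_le_card_of_mem_stringsOn hEW).trans hW
  have hlt : pauliWt E < d := by omega
  rw [pauliCoeff_eq, hpure E hpos hlt, norm_zero, zero_pow two_ne_zero]

/-- **`K B'_S ≥ A'_S` in Fourier-weight form** (no detection hypothesis): for a Hermitian idempotent `P` of trace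
`K` and every qubit set `S`, `pauliWeight P S ≤ K · 2^{−n} 4^{|S|} · pauliWeight P Sᶜ` (termwise `K B_E − A_E ≥ 0`
summed over the words supported on `S`, then the duality `B'_S = A'_{Sᶜ}`).
[cite: Rains1998Enumerators, §2 Thm. 8 («for 0 ≤ i ≤ n, K B'_i(P,P) ≥ A'_i(P,P)»)] -/
theorem pauliWeight_le_mul_pauliWeight_compl {P : Matrix (ι → Bool) (ι → Bool) ℂ} (hH : P.IsHermitian)
    (hPP : P * P = P) {K : ℕ} (htr : P.trace = (K : ℂ)) (S : Finset ι) :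
    pauliWeight P S ≤ K * ((2 ^ Fintype.card ι)⁻¹ * 4 ^ #S * pauliWeight P Sᶜ) := by
  have h1 : pauliWeight P S ≤ K * (slBOn P P S).re := by
    rw [pauliWeight_eq, slBOn, Complex.re_sum, Finset.mul_sum]
    exact Finset.sum_le_sum fun E _ => norm_pauliCoeff_sq_le hH hPP htr E
  have h2 : (slBOn P P S).re = (2 ^ Fintype.card ι)⁻¹ * 4 ^ #S * pauliWeight P Sᶜ := by
    rw [slBOn_eq_slAOn_compl, slAOn_self_of_isHermitian hH]
    have h : ((2 : ℂ) ^ Fintype.card ι)⁻¹ * 4 ^ #S * (pauliWeight P Sᶜ : ℂ) =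
        (((2 ^ Fintype.card ι)⁻¹ * 4 ^ #S * pauliWeight P Sᶜ : ℝ) : ℂ) := by push_cast; ring
    rw [h, Complex.ofReal_re]
  rwa [h2] at h1

/-- **«If `K = 1`, then `B'_i(P,P) = A'_i(P,P)` for all `i`»**, in Fourier-weight form: for a Hermitian idempotent of
trace `1`, `2ⁿ · pauliWeight P S = 4^{|S|} · pauliWeight P Sᶜ` for every `S` (the two inequalities
`A'_S ≤ B'_S = A'_{Sᶜ} ≤ B'_{Sᶜ} = A'_S` close up). [cite: Rains1998Enumerators, §2 Thm. 8 («Finally, if K = 1 …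
so `B'_i(P,P) = A'_i(P,P)`»)] -/
theorem pauliWeight_rank_one (P : Matrix (ι → Bool) (ι → Bool) ℂ) (hH : P.IsHermitian) (hPP : P * P = P)
    (htr : P.trace = ((1 : ℕ) : ℂ)) (S : Finset ι) :
    2 ^ Fintype.card ι * pauliWeight P S = (1 : ℕ) * 4 ^ #S * pauliWeight P Sᶜ := by
  have hS := pauliWeight_le_mul_pauliWeight_compl hH hPP htr S
  have hSc := pauliWeight_le_mul_pauliWeight_compl hH hPP htr Sᶜ
  rw [compl_compl, Finset.card_compl] at hSc
  simp only [Nat.cast_one, one_mul] at hS hSc ⊢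
  have h2n : (0 : ℝ) < 2 ^ Fintype.card ι := by positivity
  have h4 : (4 : ℝ) ^ #S * 4 ^ (Fintype.card ι - #S) = 2 ^ Fintype.card ι * 2 ^ Fintype.card ι := by
    rw [← pow_add, Nat.add_sub_cancel' (Finset.card_le_univ S), ← mul_pow]; norm_num
  have hx : 0 ≤ pauliWeight P S := pauliWeight_nonneg P S
  -- combine: `a_S ≤ c 4^{|S|} a_{Sᶜ} ≤ c 4^{|S|} c 4^{n−|S|} a_S = a_S`
  have key : (2 ^ Fintype.card ι)⁻¹ * 4 ^ #S * pauliWeight P Sᶜ ≤ pauliWeight P S := by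
    calc (2 ^ Fintype.card ι)⁻¹ * 4 ^ #S * pauliWeight P Sᶜ
        ≤ (2 ^ Fintype.card ι)⁻¹ * 4 ^ #S * ((2 ^ Fintype.card ι)⁻¹ * 4 ^ (Fintype.card ι - #S) * pauliWeight P S) := by gcongr
      _ = ((4 : ℝ) ^ #S * 4 ^ (Fintype.card ι - #S)) / (2 ^ Fintype.card ι * 2 ^ Fintype.card ι) * pauliWeight P S := by
          field_simp
      _ = pauliWeight P S := by rw [h4, div_self (by positivity), one_mul]
  have heq : pauliWeight P S = (2 ^ Fintype.card ι)⁻¹ * 4 ^ #S * pauliWeight P Sᶜ := le_antisymm hS key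
  rw [heq]
  field_simp

/-- A rank-one projection detects every Pauli word (`P E P = ⟨v|E|v⟩ P`): for `K = 1` the Knill–Laflamme condition is
automatic at every weight. [cite: Rains1998Enumerators, §2 Thm. 8 (K = 1 clause) with Thm. 11] -/
theorem detectsWeightLE_rank_one {P : Matrix (ι → Bool) (ι → Bool) ℂ} (hH : P.IsHermitian) (hPP : P * P = P)
    (htr : P.trace = ((1 : ℕ) : ℂ)) (t : ℕ) : DetectsWeightLE P t :=
  (detectsWeightLE_iff_forall_pauliWeight hH hPP htr t).2 fun S _ => pauliWeight_rank_one P hH hPP htr S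

/-- **The `K = 1` clause of the quantum Singleton bound**: a PURE `((n,1,d))` on `n ≥ 1` qubits satisfies
`2(d−1) ≤ n`, i.e. `2d ≤ n + 2` («Similarly, a pure `((n,1,d))_α` satisfies `2d ≤ n+2`»). The hypothesis `n ≥ 1`
(implicit in print) excludes the empty register, where purity is vacuous. Proof: for `|S| = d − 1`, purity gives
`pauliWeight P S = 1`, the `K = 1` identity gives `2ⁿ = 4^{d−1} pauliWeight P Sᶜ ≥ 4^{d−1}`.
[cite: Rains1999Nonbinary, Thm. 2 p. 1828 (K = 1 clause: «If `2d > n+2`, then `A'_{n−d+1} = A'_{d−1}` gives a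
contradiction»)] -/
theorem two_mul_le_of_pure_rank_one {d : ℕ} {P : Matrix (ι → Bool) (ι → Bool) ℂ} (hn : 0 < Fintype.card ι)
    (hP : IsCodeProjection P 1 d) (hpure : IsPureToWeight P d) : 2 * (d - 1) ≤ Fintype.card ι := by
  classical
  obtain ⟨hH, hPP, htr, _⟩ := hP
  have h1 : ‖P.trace‖ ^ 2 = 1 := by rw [htr]; simp
  by_cases hdn : d - 1 ≤ Fintype.card ι
  · obtain ⟨S, -, hS⟩ := Finset.exists_subset_card_eq (s := (Finset.univ : Finset ι)) (n := d - 1)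
      (by rwa [Finset.card_univ])
    have hw := pauliWeight_rank_one P hH hPP htr S
    rw [pauliWeight_eq_of_pure hpure hS.le, h1, hS, Nat.cast_one, one_mul, mul_one] at hw
    -- `2ⁿ = 4^{d−1} a_{Sᶜ} ≥ 4^{d−1}`
    have hge : (1 : ℝ) ≤ pauliWeight P Sᶜ := by
      rw [← h1, ← pauliWeight_empty]
      exact pauliWeight_mono P (Finset.empty_subset _)
    have h4 : (4 : ℝ) ^ (d - 1) ≤ 2 ^ Fintype.card ι := by
      rw [hw]; exact le_mul_of_one_le_right (by positivity) hge
    have h4' : (2 : ℝ) ^ (2 * (d - 1)) ≤ 2 ^ Fintype.card ι := by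
      rw [pow_mul]; norm_num; exact h4
    exact_mod_cast (pow_le_pow_iff_right₀ (by norm_num : (1 : ℝ) < 2)).1 h4'
  · -- `d − 1 > n`: all of `univ` is «small», so `2ⁿ = 4ⁿ`, i.e. `n = 0` — excluded
    exfalso
    push Not at hdn
    have hw := pauliWeight_rank_one P hH hPP htr Finset.univ
    rw [pauliWeight_eq_of_pure hpure (by rw [Finset.card_univ]; omega), h1, Finset.card_univ, Nat.cast_one, one_mul,
      Finset.compl_univ, pauliWeight_empty, h1, mul_one, mul_one] at hw
    have h : (2 : ℝ) ^ Fintype.card ι < 4 ^ Fintype.card ι := pow_lt_pow_left₀ (by norm_num) (by norm_num) hn.ne'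
    rw [hw] at h
    exact lt_irrefl _ h

end Literature.InformationTheory.QuantumCodes
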